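import Summits.BirchSwinnertonDyer.BirchSwinnertonDyer.Theorems.ClassRecordThreeEulerHalvesAtThreeShimuraInertSavingDisplayOfLabels
import HarnessLib

/-!
# KOLYVAGIN'S ORDER BOUND REFINED BY GLOBAL DIVISIBILITY AT ANY ODD INERT `p ∈ S`, IMAGE-KEYED — the `p`-generic form of tam3-p1 g11's D7
# (cell `bsd-stepL`, seat `bsd-stepL-corner3-p2` g9 = WIDTH-LEVER lane B; `--supports stmt-BirchSwinnertonDyer-21420 --as helper`; serves crux 19065's
# `stub_savedDisplay57` road at `p ∈ {5, 7}`; at `p = 3` it is D7 `padicValNat_card_sha_three_primary_add_le_of_shimuraLabels_of_irr_of_casselsTate_of_divLab`)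

WHAT. `ShimuraKolyvaginOfImage.padicValNat_card_sha_primary_add_le_of_shimuraLabels_ofImage_of_casselsTate_of_divLab`:
`ord_p #Ш(E/K)[p^∞] + 2t ≤ 2·ord_p [E(K):ℤy]` for the bottom point `y` of a bare CM family on `X_{N⁺,N⁻}` carrying the printed labels (B2)–(B5), the
guarded index clause and the label-side global divisibility `hDivLab` to depth `t`, for ANY odd prime `p ∈ S` (inert, unramified in `K`), `E[p]` irreducible
over `ℚ`, from `casselsTate_levelInputs K` and the four mod-`p` IMAGE INPUTS over `K` (hIz: `−1` in the image; hIs: irreducible over `K`; hIc: scalar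
centraliser; hIt: `E(K)[p] = 0`) — tam3-p1 g11's D7 VERBATIM with `3 ↦ p` and the image inputs DISPLAYED instead of
`kolyvaginImageInputs_three_of_mem_inertSet`; the engines it calls (D6 `padicValNat_card_sha_primary_add_le_of_ringClassRationalPointsMDiv_shift_of_poitouTate_of_localDuality_ofImage`,
`natCard_primaryComponent_sha_le_of_ringClassRationalPointsM_shift_of_poitouTate_ofImage`, `hpointsRkDiv_of_shimuraLabels_of_noTorsion_of_divLab`,
x11b3's `NoTorsionIrr.torsionBy_pow_ringClassField_eq_bot_of_hasIrreducibleModPGaloisRep`) are already `p`-generic and image-keyed. Poitou–Tate over `K` is the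
tree THEOREM `poitouTate_sum_localTatePairing_eq_zero_holds`.

WHY. With lane B g9's `Koly.shimuraDivClause_of_poitouTate_ofImage` (p611034: the `hDivLab` binder at `t ≤ ord_p c_q`, `q ∉ S`, from Poitou–Tate for
Selmer structures + `LabelsAt ∧ LabelB6` + the image inputs) this gives, at every odd `p ∈ S` and every `K` with `d_K < −4`, the SAVED order bound
`ord_p #Ш(E/K)[p^∞] + 2·ord_p c_{q₁}(E) ≤ 2·ord_p [E(K):ℤy]` for `q₁ ∉ S` — the non-print half of `Theorems.ShimuraInertSavedDisplayAtD W p q₁` — modulo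
{(B6), the image inputs, the two Poitou–Tate inputs, `casselsTate_levelInputs`}; at `p ∈ {5, 7}` on the T4′ corner (crux 19065 hybrid r5
`stub_savedDisplay57`) corner-p1 supplies the image inputs; the assembly with the printed primitives `shimuraCurve_heegnerSystem_primitivesFromFiveIrr`
and the D-form of the stub is corner-p1's (line owner).

HONEST FRAMING: ONE conditional theorem; no definition, no named fact, no `sorry`; nothing booked; no stub ∕ item closes; no census label moves (T7);
BSD is not proved by any of this. Credit: tam3-p1 g9–g11 (SHIFT×DIV chain D5–D8), lane B g5 (image-keyed ORDER machine), x11b3 (no-torsion), bsd-jet.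
References (locators only): [cite: McCallumLMS1991, §1 Theorem (Kolyvagin), §4 Cor. 4.5, §5 Lemma 5.1, Cor. 5.6] [cite: Jetchev2008, Thm. 1.1, (1), Cor. 1.5]
[cite: GrossLMS1991, §2, §§3–5, §9, §10] [cite: Kim2022HigherGZ, Thm. 4.3, Rem. 7.9] [cite: MilneADT2006, Ch. I Thm. 4.10(b), Thm. 6.13(a)].
presearch: not applicable (generalisation of a tree theorem). Axioms: `propext`, `Classical.choice`, `Quot.sound`.
-/

set_option autoImplicit false
set_option linter.dupNamespace false

noncomputable section

open scoped Classical AddSubgroup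

open WeierstrassCurve NumberField IsDedekindDomain Field Function Finset Literature.NumberTheory.EllipticCurves
  Literature.NumberTheory.GaloisRepresentations Literature.NumberTheory.GaloisCohomology
  Literature.NumberTheory.EllipticCurves.KolyvaginCocycle Literature.NumberTheory.EllipticCurves.RingClassField
  Literature.NumberTheory.EllipticCurves.ModularForms Literature.NumberTheory.EllipticCurves.Rank1Residual
  Literature.NumberTheory.EllipticCurves.KolyvaginEuler Literature.NumberTheory.EllipticCurves.KolyvaginDescent
  Summit.BirchSwinnertonDyer.Rank1Residual Summit.BirchSwinnertonDyer.Rank1Residual.X11b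

namespace Summit.BirchSwinnertonDyer.BirchSwinnertonDyer.Theorems.ShimuraKolyvaginOfImage

variable {K : Type} [Field K] [NumberField K] {W : WeierstrassCurve ℚ}

/-- **Kolyvagin's ORDER bound at an odd inert `p ∈ S`, image-keyed, REFINED BY GLOBAL DIVISIBILITY:
`ord_p #Ш(E/K)[p^∞] + 2t ≤ 2·ord_p[E(K):ℤy]`** for the bottom point `y` of a bare CM family on `X_{N⁺,N⁻}` carrying the printed
labels (B2)–(B5), the guarded index clause AND the label-side global divisibility `hDivLab` to depth `t`, from `casselsTate_levelInputs K`
and the four mod-`p` image inputs over `K` — tam3-p1 g11's D7 VERBATIM with `3 ↦ p` and the image inputs displayed.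
CONDITIONAL on `hCT`, the labels, the image inputs and `hDivLab`; nothing booked.
[cite: McCallumLMS1991, §1 Theorem (Kolyvagin), §4 Cor. 4.5, Lemma 5.1, Cor. 5.6] [cite: Jetchev2008, Thm. 1.1, (1), Cor. 1.5]
[cite: GrossLMS1991, §2, §9, §10] [cite: Kim2022HigherGZ, Thm. 4.3, Rem. 7.9] [cite: MilneADT2006, Ch. I Thm. 4.10(b), Thm. 6.13(a)] -/
theorem padicValNat_card_sha_primary_add_le_of_shimuraLabels_ofImage_of_casselsTate_of_divLab
    (hCT : Literature.NumberTheory.EllipticCurves.casselsTate_levelInputs K)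
    [W.IsElliptic] [W.IsGloballyMinimal] {N : ℕ} [NeZero N] (hN : W.conductorNorm ℤ = N)
    {p : ℕ} [Fact p.Prime] (hp2 : p ≠ 2)
    (hirr : W.HasIrreducibleModPGaloisRep p) (hK : IsImaginaryQuadratic K) (ι : K →+* ℂ)
    (Dt : ModularParametrizationData W N) {S : Finset ℕ}
    (hin : ∀ ℓ ∈ S, ℓ.Prime ∧ ℓ ∣ N ∧ ¬ ℓ ^ 2 ∣ N ∧
      ((Ideal.span {(ℓ : ℤ)}).primesOver (𝓞 K)).ncard = 1 ∧ ¬ (ℓ : ℤ) ∣ NumberField.discr K)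
    (hsp : ∀ ℓ : ℕ, ℓ.Prime → ℓ ∣ N → ℓ ∉ S → ((Ideal.span {(ℓ : ℤ)}).primesOver (𝓞 K)).ncard = 2)
    (hpS : p ∈ S)
    -- the four mod-`p` IMAGE INPUTS over `K` (corner-p1's `_ofImage` binders; at `p = 3` = `kolyvaginImageInputs_three_of_mem_inertSet`)
    (hIz : ∃ z : Field.absoluteGaloisGroup K, ∀ t : geomTorsion (W.baseChange K) p, z • t = -t)
    (hIs : (W.baseChange K).HasIrreducibleModPGaloisRep p)
    (hIc : ∀ f : geomTorsion (W.baseChange K) p →+ geomTorsion (W.baseChange K) p,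
      (∀ (g : Field.absoluteGaloisGroup K) (t : geomTorsion (W.baseChange K) p), f (g • t) = g • f t) →
        ∃ k : ℤ, ∀ t, f t = k • t)
    (hIt : AddSubgroup.torsionBy (W.baseChange K).toAffine.Point (p : ℤ) = ⊥)
    (ys : (m : ℕ) → (W.baseChange (ringClassField K ι m)).toAffine.Point)
    {y : (W.baseChange K).toAffine.Point} {ε : ℤ} (hε : ε = 1 ∨ ε = -1)
    (hguard : ¬ IsOfFinAddOrder y → 0 < (AddSubgroup.zmultiples y).index)
    (hB2 : ∀ T : Finset (ringClassField K ι 1 ≃ₐ[ℚ] ringClassField K ι 1),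
      (∀ g, g ∈ T ↔ g ∈ ringClassGal ι 1) →
      WeierstrassCurve.Affine.Point.map (W' := W)
          (algebraMap K (ringClassField K ι 1)).toRatAlgHom y =
        ∑ g ∈ T, pointGalHom W (ringClassField K ι 1) g (ys 1))
    (hB3 : ∀ (m : ℕ), m ≠ 0 → ∀ τm : ringClassField K ι m ≃ₐ[ℚ] ringClassField K ι m,
      (∀ x : ringClassField K ι m, ((τm x : ringClassField K ι m) : ℂ) = starRingEnd ℂ x) →
      ∃ σ' ∈ ringClassGal ι m, IsOfFinAddOrder
        (pointGalHom W (ringClassField K ι m) τm (ys m) -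
          ε • pointGalHom W (ringClassField K ι m) σ' (ys m)))
    (hB3K : ∀ c : K ≃ₐ[ℚ] K, c ≠ 1 →
      IsOfFinAddOrder (WeierstrassCurve.Affine.Point.map (W' := W) (c : K →ₐ[ℚ] K) y - ε • y))
    (hB4 : ∀ m : ℕ, Squarefree m →
      (∀ q ∈ m.primeFactors, ¬ q ∣ N ∧ (Ideal.span {(q : 𝓞 K)}).IsPrime) →
      ∀ (ℓ : ℕ) (_ : ℓ ∈ m.primeFactors) (hle : ringClassField K ι (m / ℓ) ≤ ringClassField K ι m)
        (σ : ringClassField K ι m ≃ₐ[ℚ] ringClassField K ι m),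
        Subgroup.zpowers σ = ringClassGalOver ι m (m / ℓ) →
        letI : Algebra K ℂ := ι.toAlgebra
        ∑ i ∈ Finset.range (ℓ + 1), pointGalHom W (ringClassField K ι m) (σ ^ i) (ys m) =
          W.frobeniusTrace ℓ • WeierstrassCurve.Affine.Point.map (W' := W)
            ((RingClassField.inclusion ι hle).restrictScalars ℚ) (ys (m / ℓ)))
    (hB5 : ∀ m : ℕ, Squarefree m →
      (∀ q ∈ m.primeFactors, ¬ q ∣ N ∧ (Ideal.span {(q : 𝓞 K)}).IsPrime) →
      ∀ (ℓ : ℕ) (_ : ℓ ∈ m.primeFactors) [Fact ℓ.Prime] (hΔ : ¬ (ℓ : ℤ) ∣ minimalDiscriminantInt W)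
        (φ₀ : absoluteGaloisGroup (ZMod ℓ)), (∀ x : AlgebraicClosure (ZMod ℓ), φ₀ • x = x ^ ℓ) →
      ∀ (hle : ringClassField K ι (m / ℓ) ≤ ringClassField K ι m)
        (emb : ringClassField K ι m →+* AlgebraicClosure K),
        (∀ x : K, emb (algebraMap K (ringClassField K ι m) x) = algebraMap K (AlgebraicClosure K) x) →
      ∀ (j : (W.baseChange (ringClassField K ι m)).toAffine.Point →+ geomPoints (W.baseChange K)),
        j = WeierstrassCurve.Affine.Point.map (W' := W) emb.toRatAlgHom →
      ∀ γ : ringClassField K ι m ≃ₐ[ℚ] ringClassField K ι m, γ ∈ ringClassGal ι m →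
        letI : Algebra K ℂ := ι.toAlgebra
        geomReduction hΔ ((RatClosure.pointsEquiv (K := K) W).symm
            (j (pointGalHom W (ringClassField K ι m) γ (ys m)))) =
          φ₀ • geomReduction hΔ ((RatClosure.pointsEquiv (K := K) W).symm
            (j (pointGalHom W (ringClassField K ι m) γ
              (WeierstrassCurve.Affine.Point.map (W' := W)
                ((RingClassField.inclusion ι hle).restrictScalars ℚ) (ys (m / ℓ)))))))
    -- LABEL-SIDE GLOBAL DIVISIBILITY to depth `t` (D6's `hDivLab`, at `p`)
    (t : ℕ)
    (hDivLab : ∀ (k M k' : ℕ), Squarefree k' →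
      (∀ q ∈ k'.primeFactors, IsKolyvaginPrime N W K p q ∧ FrobEqFrobInfty W K (p ^ (M + k)) q) →
      letI : CommGroup (ringClassGal ι k') := { (inferInstance : Group (ringClassGal ι k')) with
        mul_comm := fun a b ↦ (KolyvaginH44.isMulCommutative_ringClassGal' hK ι k').is_comm.comm a b }
      letI : DistribMulAction (ringClassGal ι k') ((W.baseChange (ringClassField K ι k')).toAffine.Point) :=
        DistribMulAction.compHom _ ((pointGalHom W (ringClassField K ι k')).comp (ringClassGal ι k').subtype)
      ∀ (σ' : ℕ → ringClassGal ι k') (H' : Subgroup (ringClassGal ι k')) [Fintype (ringClassGal ι k' ⧸ H')]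
        (f' : ringClassGal ι k' ⧸ H' → ringClassGal ι k'),
        (∀ q ∈ k'.primeFactors, σ' q ^ (q + 1) = 1) →
        (∀ q ∈ k'.primeFactors, Subgroup.zpowers (σ' q : ringClassField K ι k' ≃ₐ[ℚ] ringClassField K ι k') =
          ringClassGalOver ι k' (k' / q)) →
        (∀ c, (f' c : ringClassGal ι k' ⧸ H') = c) →
        (∀ h ∈ H', (h : ringClassField K ι k' ≃ₐ[ℚ] ringClassField K ι k') ∈ ringClassGalOver ι k' 1) →
        ∃ B : (W.baseChange (ringClassField K ι k')).toAffine.Point,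
          ((p ^ M : ℕ) : ℤ) • B = ((p : ℤ) ^ (M - t)) • kolyvaginPoint σ' k'.primeFactors f' (ys k'))
    (hnt : ¬ IsOfFinAddOrder y) :
    padicValNat p (Nat.card (AddCommGroup.primaryComponent (W.baseChange K).sha p)) + 2 * t ≤
      2 * padicValNat p (AddSubgroup.zmultiples y).index := by
  haveI hEK : (W.baseChange K).IsElliptic := inferInstanceAs (W.map (algebraMap ℚ K)).IsElliptic
  -- Poitou–Tate over `K` is a tree THEOREM (`PoitouTateNumberField.lean`)
  have hPT : poitouTate_sum_localTatePairing_eq_zero K := poitouTate_sum_localTatePairing_eq_zero_holds K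
  have hp : p.Prime := Fact.out
  have h3d : ¬ ((p : ℕ) : ℤ) ∣ NumberField.discr K := (hin p hpS).2.2.2.2
  -- (i) the four image inputs at `p` are HYPOTHESES here
  -- (ii) no `p`-power torsion over the ring class fields of conductor prime to `p` (x11b3, from `Irr`)
  have hKunr : ∀ v : HeightOneSpectrum (𝓞 ℚ), ((p : ℕ) : 𝓞 ℚ) ∈ v.asIdeal →
      Algebra.IsUnramifiedIn (𝓞 K) v.asIdeal := isUnramifiedIn_rat_of_not_dvd_discr K hp h3d
  have htor : ∀ k' : ℕ, k' ≠ 0 → ¬ p ∣ k' →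
      ∀ (n' : ℕ) (a : (W.baseChange (ringClassField K ι k')).toAffine.Point),
        ((p ^ n' : ℕ) : ℤ) • a = 0 → a = 0 := by
    intro k' hk' h3k' n' a ha
    have hbot := NoTorsionIrr.torsionBy_pow_ringClassField_eq_bot_of_hasIrreducibleModPGaloisRep W hK ι hk' hp hp2
      hirr (W.exists_weilPairing_holds p) hKunr h3k' n'
    have hmem : a ∈ AddSubgroup.torsionBy (W.baseChange (ringClassField K ι k')).toAffine.Point ((p ^ n' : ℕ) : ℤ) :=
      (Submodule.mem_torsionBy_iff _ _).mpr ha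
    rwa [hbot, AddSubgroup.mem_bot] at hmem
  -- the depth-`k` ring-class-rational Div-carrier on `y` from the labels (D6)
  have hpointsRk := hpointsRkDiv_of_shimuraLabels_of_noTorsion_of_divLab hK ι hN Dt hp hp2 htor ys hε hB2 hB3 hB3K hB4
    hB5 t hDivLab
  have hidx : 0 < (AddSubgroup.zmultiples y).index := hguard hnt
  -- the level `M₀ = ord_p [E(K):ℤy]`
  set M₀ : ℕ := padicValNat p (AddSubgroup.zmultiples y).index with hM₀def
  have hv : padicValNat p (AddSubgroup.zmultiples y).index = M₀ := rfl
  rcases Nat.eq_zero_or_pos M₀ with h0M | hpos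
  · -- unit index: `Ш(E/K)[p^∞] = 0` by the parents' `M₀ = 0` END (divisibility conjunct dropped), and `t = 0` from the
    -- divisibility at `m = 1`, level `p` (`δ_p y = 0 ⟹ y ∈ pE(K)`, contradicting `p ∤ [E(K):ℤy]`)
    rw [h0M] at hv
    have hcard := natCard_primaryComponent_sha_le_of_ringClassRationalPointsM_shift_of_poitouTate_ofImage hPT W hN hp2
      hIz hIs hIc hIt hK ι hin hsp hnt hidx hv (fun k M hM hdiv c hc ↦ by
        obtain ⟨ε', τ, hτ, A, hA, emb, Pt, hPt, hε', h53, hAτ, hPt1, hrat, hAk, hm'⟩ := hpointsRk k hM hdiv c hc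
        exact ⟨ε', τ, hτ, A, hA, emb, Pt, hPt, hε', h53, hAτ, hPt1, hrat, hAk, fun m hm hk ↦
          ⟨(hm' m hm hk).1, (hm' m hm hk).2.1, (hm' m hm hk).2.2.1⟩⟩)
    rw [hv, mul_zero, pow_zero] at hcard
    have hv0 : padicValNat p (Nat.card (AddCommGroup.primaryComponent (W.baseChange K).sha p)) = 0 := by
      rw [padicValNat.eq_zero_iff]
      rcases Nat.le_one_iff_eq_zero_or_eq_one.mp hcard with h | h
      · exact Or.inr (Or.inl h)
      · exact Or.inr (Or.inr (by rw [h]; exact hp.one_lt.ne' ∘ Nat.dvd_one.mp))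
    have hAp : ∀ a : (W.baseChange K).toAffine.Point, ((p : ℕ) : ℤ) • a = 0 → a = 0 := fun a ha ↦ by
      have : a ∈ AddSubgroup.torsionBy (W.baseChange K).toAffine.Point ((p : ℕ) : ℤ) := by
        rw [mem_torsionBy_iff]; exact ha
      rw [hIt] at this
      exact this
    obtain ⟨-, hmax'⟩ :=
      Summit.BirchSwinnertonDyer.Rank1Residual.Additive.zsmul_certificate_of_padicValNat_index hp hAp hnt hidx.ne' hv
    obtain ⟨c, hc1, -⟩ := exists_conj_of_isImaginaryQuadratic (K := K) hK
    have ht : t = 0 := by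
      by_contra ht0
      have hdiv1 : ∀ Q : geomPoints (W.baseChange K), ∃ R, ((p ^ 1 : ℕ) : ℤ) • R = Q := fun Q ↦
        (W.baseChange K).zsmul_geomPoints_surjective_holds (by exact_mod_cast pow_ne_zero 1 hp.ne_zero) Q
      obtain ⟨ε', τ, hτ, A, hA, emb, Pt, hPt, -, -, -, hPt1, -, -, hm'⟩ := hpointsRk 0 le_rfl hdiv1 c hc1
      have h1 := (hm' 1 squarefree_one (by simp)).2.2.2
      rw [show 1 - t = 0 by omega, pow_zero, one_smul] at h1
      have hP1 : toGeomPoints (W.baseChange K) y ∈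
          KolyvaginCocycle.invPoints (Field.absoluteGaloisGroup K) (A 1) ((p ^ 1 : ℕ) : ℤ) := by
        rw [← hPt1]; exact hPt 1
      rw [kolyvaginClass_congr_point (hA 1) (hP' := hP1) hPt1, kolyvaginClass_toGeomPoints (hA 1) y hP1] at h1
      have hker : y ∈ (kummerMapTorsion (W.baseChange K) _ hdiv1).ker := by
        rw [AddMonoidHom.mem_ker, h1]
      rw [kummerMapTorsion_ker, AddMonoidHom.mem_range] at hker
      obtain ⟨z, hz⟩ := hker
      exact hmax' ⟨z, hz⟩
    omega
  -- divisible index: the REFINED ORDER form at level `p^{M₀}`, `M₀ ≥ 1` (D5)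
  haveI : NeZero (p ^ M₀) := ⟨pow_ne_zero _ hp.ne_zero⟩
  obtain ⟨c, hc1, hcc⟩ := exists_conj_of_isImaginaryQuadratic (K := K) hK
  have h2 : 2 ≤ p ^ M₀ * p ^ M₀ :=
    le_trans (le_trans hp.two_le (Nat.le_self_pow hpos.ne' p)) (Nat.le_mul_of_pos_right _ (NeZero.pos (p ^ M₀)))
  have hq : ((p ^ M₀ * p ^ M₀ : ℕ) : K) ≠ 0 := Nat.cast_ne_zero.mpr (NeZero.ne (p ^ M₀ * p ^ M₀))
  obtain ⟨e, hμ, hadd₁, hadd₂, halt, hnd, hgal⟩ := exists_weilPairing_holds (W.baseChange K) (p ^ M₀ * p ^ M₀) h2 hq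
  obtain ⟨inv, hPT', hH3, hperf, hB, hPτ⟩ := hCT W p M₀ hp hp2 hpos c hc1 hcc e hμ hadd₁ hadd₂ hgal halt hnd
  exact padicValNat_card_sha_primary_add_le_of_ringClassRationalPointsMDiv_shift_of_poitouTate_of_localDuality_ofImage
    hPT W hN hp2 hIz hIs hIc hIt hK ι hin hsp hnt hidx hv hc1 hcc t hpointsRk e hμ hadd₁ hadd₂ hgal halt hnd inv hPT'
    (fun v ↦ (hperf v).1.injective) hH3 hB hPτ

end Summit.BirchSwinnertonDyer.BirchSwinnertonDyer.Theorems.ShimuraKolyvaginOfImage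

end
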